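import Literature.NumberTheory.EllipticCurves.FrobeniusTateModuleTraceProofs
import Literature.NumberTheory.EllipticCurves.FrobeniusDegreeProofs
import Literature.NumberTheory.EllipticCurves.IsogenyFrobeniusFactorProofs
import Literature.NumberTheory.EllipticCurves.IsogenyDegreeQuadraticFormProofs
import Literature.NumberTheory.EllipticCurves.IsogenyHomProofs
import Literature.NumberTheory.EllipticCurves.HasseManin
import HarnessLib

/-!
# The trace of Frobenius of a supersingular elliptic curve: `q ∣ a²`, hence `a² ∈ {0, q, 2q, 3q, 4q}`

Topic `NumberTheory/EllipticCurves`. A *proofs* file (theorems only; nothing is defined, no named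
fact is introduced) over the prelude `Literature.NumberTheory.EllipticCurves.Isogeny`, first step
of the tree's proof of **Deuring's theorem** that a supersingular elliptic curve has a
non-commutative (quaternionic) endomorphism ring (M. Deuring 1941; Silverman, *AEC*, Thm. V.3.1(a):
`E[p] = 0` implies `End(E)` is an order in a quaternion algebra), along the finite-field road of
Waterhouse, *Abelian varieties over finite fields*, Ann. Sci. ÉNS 2 (1969), Ch. 4, Thm. 4.1 and its
proof: for `E` over `k = 𝔽_q`, `q = pⁿ`, with Frobenius `π`, `π² - aπ + q = 0`, `a = q + 1 - #E(k)`,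

* `WeierstrassCurve.card_dvd_trace_sq_of_forall_nsmul_ne_zero` — **if `E(k̄)` has no point of
  order `p` then `q ∣ a²`.** Proof (Silverman, *AEC*, proof of Thm. V.3.1(a) / Ex. V.5.10, by
  degrees instead of the Hasse invariant, exactly as the tree's `dvd_trace_of_forall_nsmul_ne_zero`
  in `SupersingularDensityDeuringCriterionProofs`, whose argument is repeated here verbatim but
  read off to the end): `π` (degree `q`, *AEC* II.2.11(c), the tree's
  `frobeniusIsogeny_deg_eq_card_holds`) and `α = [a] - π` (degree `q`, as `α ∘ π = [q]`) are both
  injective on points when `E(k̄)[p] = 0`, so by *AEC* Cor. II.2.12 (the tree's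
  `Isogeny.exists_eq_comp_frobeniusTwistIsogeny`) both factor through the `q`-power Frobenius
  `F : E → E^{(q)}` with factors of degree `1`; hence `[a] = π + α = μ ∘ F` and
  `a² = deg [a] = deg μ · q` (or `[a] = 0`, `a = 0`).
* `WeierstrassCurve.trace_sq_le_four_mul_card` — **Hasse: `a² ≤ 4q`** (the integer form of the
  tree's theorem `Literature.NumberTheory.EllipticCurves.HasseManin.abs_card_sub_le`,
  `|#E(k) - q - 1| ≤ 2√q`, Silverman, *AEC*, Thm. V.1.1).
* `WeierstrassCurve.exists_trace_sq_eq_mul_card_of_forall_nsmul_ne_zero` — hence **`a² = c q` with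
  `c ∈ {0, 1, 2, 3, 4}`** for a supersingular curve (Waterhouse 1969, Thm. 4.1: the supersingular
  Weil numbers of elliptic curves have `β = a ∈ {0, ±√q, ±√(2q), ±√(3q), ±2√q}`; Silverman, *AEC*,
  Ex. V.5.10 / proof of Thm. V.3.1).

The sequel (`SupersingularFrobeniusPowerProofs`) deduces `π²⁴ = q¹²` and, with Tate's theorem over
finite fields (the tree's `exists_endRing_mul_ne_mul_of_frobenius_smul_eq_zsmul`), the
non-commutativity of `End(E)`.

## References

* [SilvermanAEC2009] J. H. Silverman, *The Arithmetic of Elliptic Curves*, 2nd ed., GTM 106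
  (2009): Cor. II.2.12, Prop. II.2.11(c), Cor. III.6.3, Thm. V.1.1, Thm. V.2.3.1, Thm. V.3.1(a),
  Ex. V.5.10.
* [Waterhouse1969] W. C. Waterhouse, *Abelian varieties over finite fields*, Ann. Sci. ÉNS (4) 2
  (1969), 521–560, Ch. 4, Thm. 4.1.
* [Deuring1941] M. Deuring, *Die Typen der Multiplikatorenringe elliptischer Funktionenkörper*,
  Abh. Math. Sem. Univ. Hamburg 14 (1941), 197–272.

## Design

`noncomputable section`, `open scoped Classical`, one universe `u`; deliberate dot-notation
extensions in `namespace WeierstrassCurve` (the namespace of the prelude `Isogeny` and of the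
sibling proofs files `SupersingularDensityDeuringCriterionProofs`, `DeuringSplitOrdinaryProofs`).
Nothing is defined and no named fact is introduced (D-0026).
-/

noncomputable section

open scoped Classical

universe u

namespace WeierstrassCurve

open Literature.NumberTheory.EllipticCurves

variable {K : Type u} [Field K]

section Trace

variable [Finite K] (W : WeierstrassCurve K) [W.IsElliptic] (p : ℕ) [Fact p.Prime] [CharP K p]
  {σ : Field.absoluteGaloisGroup K}

/-- **`E(k̄)[p] = 0 ⇒ q ∣ a²`** for an elliptic curve `E` over a finite field `k` with `q` elements,
`a = q + 1 - #E(k)` the trace of the `q`-power Frobenius `π`. The Frobenius `π` (degree `q`,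
Silverman, *AEC*, Prop. II.2.11(c)) and `α = [a] - π` (degree `q`, since `α ∘ π = [q]` by
`π² - aπ + q = 0`, Thm. V.2.3.1(b), and `deg` is multiplicative) are injective on points when
`E(k̄)` has no point of order `p`; by Cor. II.2.12 (the tree's
`Isogeny.exists_eq_comp_frobeniusTwistIsogeny`) both factor through the `q`-power Frobenius
`F : E → E^{(q)}` with complementary factors `ι, λ` of degree `1`, so `[a] = π + α = (ι + λ) ∘ F`
and either `[a] = 0` (then `a = 0`) or `a² = deg [a] = deg (ι + λ) · q`. This is the degree
computation in Silverman's proof of Thm. V.3.1(a) ((i) ⇒ `[p] = (iso) ∘ F²`, `π̂` inseparable) in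
the form needed for Waterhouse's classification of supersingular Weil numbers (Thm. 4.1).
[cite: SilvermanAEC2009, Thm. V.3.1(a) (proof) and Ex. V.5.10(a)] -/
theorem card_dvd_trace_sq_of_forall_nsmul_ne_zero
    (hσ : ∀ x : AlgebraicClosure K, σ • x = x ^ Nat.card K)
    (hnone : ∀ P : W.geomPoints, P ≠ 0 → p • P ≠ 0) :
    ((Nat.card K : ℕ) : ℤ) ∣ ((Nat.card K : ℤ) + 1 - Nat.card W.toAffine.Point) ^ 2 := by
  have hp : p.Prime := Fact.out
  haveI : ExpChar K p := ExpChar.prime hp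
  set a : ℤ := (Nat.card K : ℤ) + 1 - Nat.card W.toAffine.Point with ha_def
  set q : ℕ := Nat.card K with hq_def
  have hq1 : 1 < q := by
    letI := Fintype.ofFinite K
    rw [hq_def, Nat.card_eq_fintype_card]
    exact Fintype.one_lt_card
  have hq0 : ((q : ℕ) : ℤ) ≠ 0 := by exact_mod_cast (by omega : q ≠ 0)
  set π := W.frobeniusIsogeny hσ with hπ_def
  set f : W.geomPoints →+ W.geomPoints := π.toAddMonoidHom with hf_def
  set g := AddMonoidHom.id W.geomPoints with hg_def
  have h63 := degHom_isQuadraticForm_holds W W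
  have hf : f ∈ homModule W W := π.toAddMonoidHom_mem_homModule
  have hg : g ∈ homModule W W := id_mem_homModule W
  have hfP : ∀ P, f P = σ • P := fun _ ↦ rfl
  have hsP : ∀ (n : ℤ) (φ : W.geomPoints →+ W.geomPoints) (P : W.geomPoints), (n • φ) P = n • φ P :=
    fun _ _ _ ↦ rfl
  have hgP : ∀ P : W.geomPoints, g P = P := fun _ ↦ rfl
  -- the Frobenius relation `f ∘ f - a f + q = 0`, pointwise
  have hrel : f.comp f - a • f + ((q : ℕ) : ℤ) • g = 0 :=
    frobeniusIsogeny_comp_sub_smul_add_smul_id_eq_zero W hσ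
  have hrelP : ∀ P, f (f P) = a • f P - ((q : ℕ) : ℤ) • P := fun P ↦ by
    have h := congrArg (fun φ : W.geomPoints →+ W.geomPoints ↦ φ P) hrel
    simp only [AddMonoidHom.add_apply, AddMonoidHom.sub_apply, AddMonoidHom.comp_apply,
      AddMonoidHom.zero_apply, hsP, hgP] at h
    rw [← sub_eq_zero, ← h]
    abel
  -- `deg π = q` and `π` is injective
  have hdegf : degHom W W f = q := by
    rw [hf_def, degHom_toAddMonoidHom, hπ_def, W.frobeniusIsogeny_deg_eq_card_holds σ hσ]
  have hinj : ∀ Q : W.geomPoints, σ • Q = 0 → Q = 0 := fun Q hQ ↦ by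
    rw [← inv_smul_smul σ Q, hQ, smul_zero]
  have hkerπ : Nat.card π.toAddMonoidHom.ker = 1 := by
    rw [Nat.card_eq_one_iff_unique]
    refine ⟨⟨fun x y ↦ Subtype.ext ?_⟩, ⟨0⟩⟩
    have hx : σ • (x : W.geomPoints) = 0 := x.2
    have hy : σ • (y : W.geomPoints) = 0 := y.2
    rw [hinj _ hx, hinj _ hy]
  -- `α = a - π`, an isogeny of degree `q` with `α ∘ π = [q]`
  set αh : W.geomPoints →+ W.geomPoints := a • g - f with hαh_def
  have hαmem : αh ∈ homModule W W := sub_mem (Submodule.smul_mem _ _ hg) hf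
  have hαhP : ∀ P, αh P = a • P - σ • P := fun P ↦ by
    rw [hαh_def, AddMonoidHom.sub_apply, hsP, hgP, hfP]
  have hαπ : αh.comp f = ((q : ℕ) : ℤ) • g := AddMonoidHom.ext fun P ↦ by
    rw [AddMonoidHom.comp_apply, hαhP, hsP, hgP, ← hfP, hrelP]
    abel
  have hdegα : degHom W W αh = q := by
    have h1 : degHom W W (αh.comp f) = ((q : ℕ) : ℤ) ^ 2 := by
      rw [hαπ, degHom_zsmul h63 hg, degHom_id, mul_one]
    rw [degHom_comp hαmem hf, hdegf] at h1
    exact mul_right_cancel₀ hq0 (by rw [h1]; ring)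
  obtain ⟨α, hα⟩ : ∃ α : Isogeny W W, α.toAddMonoidHom = αh := by
    rcases (mem_homModule_iff_holds W W αh).mp hαmem with h0 | h
    · exfalso
      rw [h0, degHom_zero] at hdegα
      exact hq0 hdegα.symm
    · exact h
  have hαP : ∀ P, α P = a • P - σ • P := fun P ↦ by
    rw [← Isogeny.coe_toAddMonoidHom, hα, hαhP]
  have hαdeg : α.deg = q := by
    have : (α.deg : ℤ) = q := by rw [← degHom_toAddMonoidHom, hα, hdegα]
    exact_mod_cast this
  -- `α` is injective on points: `α (σ P) = q P` and `E(k̄)[p^∞] = 0`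
  have hαπP : ∀ P, α (σ • P) = ((q : ℕ) : ℤ) • P := fun P ↦ by
    have h := congrArg (fun φ : W.geomPoints →+ W.geomPoints ↦ φ P) hαπ
    simp only [AddMonoidHom.comp_apply, hsP, hgP, hfP] at h
    rw [← h, ← Isogeny.coe_toAddMonoidHom, hα]
  obtain ⟨n, hn⟩ : ∃ n : ℕ, q = p ^ n := by
    letI := Fintype.ofFinite K
    obtain ⟨n, _, hn⟩ := FiniteField.card K p
    exact ⟨n, by rw [hq_def, Nat.card_eq_fintype_card, hn]⟩
  have hpow : ∀ (m : ℕ) (P : W.geomPoints), p ^ m • P = 0 → P = 0 := by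
    intro m
    induction m with
    | zero => intro P h; rwa [pow_zero, one_smul] at h
    | succ m ih =>
      intro P h
      rw [pow_succ, mul_smul] at h
      by_contra hP
      exact hnone P hP (ih _ h)
  have hkerα : Nat.card α.toAddMonoidHom.ker = 1 := by
    rw [Nat.card_eq_one_iff_unique]
    have hx0 : ∀ z : α.toAddMonoidHom.ker, (z : W.geomPoints) = 0 := fun z ↦ by
      have hz : α (z : W.geomPoints) = 0 := z.2
      have hzP : (z : W.geomPoints) = σ • (σ⁻¹ • (z : W.geomPoints)) := (smul_inv_smul σ _).symm
      rw [hzP, hαπP, natCast_zsmul, hn] at hz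
      rw [hzP, hpow n _ hz, smul_zero]
    exact ⟨⟨fun x y ↦ Subtype.ext (by rw [hx0 x, hx0 y])⟩, ⟨0⟩⟩
  -- both `π` and `α` factor through the same Frobenius `F_r`
  obtain ⟨r, ι, -, hπcomp, hιdeg, -⟩ := π.exists_eq_comp_frobeniusTwistIsogeny p
  obtain ⟨r', lam, -, hαcomp, hlamdeg, -⟩ := α.exists_eq_comp_frobeniusTwistIsogeny p
  rw [hkerπ] at hιdeg
  rw [hkerα] at hlamdeg
  have hr : p ^ r = q := by
    have h := congrArg Isogeny.deg hπcomp
    rw [Isogeny.deg_comp, hιdeg, one_mul, deg_frobeniusTwistIsogeny] at h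
    rw [← h, hπ_def]
    exact W.frobeniusIsogeny_deg_eq_card_holds σ hσ
  have hr' : r = r' := by
    have h := congrArg Isogeny.deg hαcomp
    rw [Isogeny.deg_comp, hlamdeg, one_mul, deg_frobeniusTwistIsogeny, hαdeg, ← hr] at h
    exact Nat.pow_right_injective hp.two_le h
  subst hr'
  -- `[a] = (ι + λ) ∘ F`
  set F := W.frobeniusTwistIsogeny p r with hF
  have hsum : (ι.toAddMonoidHom + lam.toAddMonoidHom).comp F.toAddMonoidHom = a • g :=
    AddMonoidHom.ext fun P ↦ by
      have h1 : π P = ι (F P) := by rw [hπcomp, Isogeny.comp_apply]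
      have h2 : α P = lam (F P) := by rw [hαcomp, Isogeny.comp_apply]
      rw [AddMonoidHom.comp_apply, AddMonoidHom.add_apply, hsP, hgP, Isogeny.coe_toAddMonoidHom,
        Isogeny.coe_toAddMonoidHom, Isogeny.coe_toAddMonoidHom, ← h1, ← h2, hαP, hπ_def,
        frobeniusIsogeny_apply]
      abel
  have hmem : ι.toAddMonoidHom + lam.toAddMonoidHom ∈ homModule (W.frobeniusTwist p r) W :=
    add_mem ι.toAddMonoidHom_mem_homModule lam.toAddMonoidHom_mem_homModule
  have hdega : degHom W W (a • g) = a ^ 2 := by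
    rw [degHom_zsmul h63 hg, degHom_id, mul_one]
  rcases (mem_homModule_iff_holds (W.frobeniusTwist p r) W _).mp hmem with h0 | ⟨μ, hμ⟩
  · -- `ι + λ = 0` gives `[a] = 0`, so `a = 0`
    rw [h0, AddMonoidHom.zero_comp] at hsum
    have h1 := hdega
    rw [← hsum, degHom_zero] at h1
    have : a = 0 := pow_eq_zero_iff two_ne_zero |>.mp h1.symm
    rw [this, zero_pow two_ne_zero]
    exact dvd_zero _
  · -- `a² = deg μ · p ^ r = deg μ · q`
    have hcomp : (μ.comp F).toAddMonoidHom = a • g := by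
      rw [← hsum, ← hμ]; rfl
    have h1 : ((μ.comp F).deg : ℤ) = a ^ 2 := by
      rw [← degHom_toAddMonoidHom, hcomp, hdega]
    rw [Isogeny.deg_comp, hF, deg_frobeniusTwistIsogeny, Nat.cast_mul, hr] at h1
    exact ⟨μ.deg, by rw [← h1]; ring⟩

omit [Fact p.Prime] [CharP K p] in
/-- **Hasse's theorem in integer form: `a² ≤ 4q`**, `a = q + 1 - #E(k)`, for an elliptic curve over
a finite field with `q` elements (Silverman, *AEC*, Thm. V.1.1; the tree's theorem
`Literature.NumberTheory.EllipticCurves.HasseManin.abs_card_sub_le`, Manin's elementary proof,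
squared). [cite: SilvermanAEC2009, Thm. V.1.1] -/
theorem trace_sq_le_four_mul_card :
    ((Nat.card K : ℤ) + 1 - Nat.card W.toAffine.Point) ^ 2 ≤ 4 * (Nat.card K : ℤ) := by
  letI := Fintype.ofFinite K
  have h := HasseManin.abs_card_sub_le W
  rw [← Nat.card_eq_fintype_card] at h
  set a : ℤ := (Nat.card K : ℤ) + 1 - Nat.card W.toAffine.Point with ha
  have habs : |(a : ℝ)| ≤ 2 * Real.sqrt (Nat.card K) := by
    rw [ha]
    push_cast
    rw [abs_sub_comm] at h
    convert h using 2
  have hsq : (a : ℝ) ^ 2 ≤ 4 * (Nat.card K : ℝ) := by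
    have h2 : |(a : ℝ)| ^ 2 ≤ (2 * Real.sqrt (Nat.card K)) ^ 2 :=
      pow_le_pow_left₀ (abs_nonneg _) habs 2
    rw [sq_abs, mul_pow, Real.sq_sqrt (Nat.cast_nonneg _)] at h2
    linarith
  exact_mod_cast hsq

/-- **The trace of a supersingular curve: `a² ∈ {0, q, 2q, 3q, 4q}`.** For an elliptic curve `E`
over a finite field `k` with `q` elements whose geometric points have no `p`-torsion,
`a² = c · q` for a natural number `c ≤ 4` (`q ∣ a²` by
`card_dvd_trace_sq_of_forall_nsmul_ne_zero` and `a² ≤ 4q` by Hasse). This is the list of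
supersingular traces in Waterhouse, Ann. Sci. ÉNS 2 (1969), Thm. 4.1 (cases (2)–(5):
`β ∈ {±2√q, ±√q, ±√(pq) (p = 2, 3), 0}`), as far as it follows from divisibility and the Riemann
hypothesis alone. [cite: Waterhouse1969, Thm. 4.1] -/
theorem exists_trace_sq_eq_mul_card_of_forall_nsmul_ne_zero
    (hσ : ∀ x : AlgebraicClosure K, σ • x = x ^ Nat.card K)
    (hnone : ∀ P : W.geomPoints, P ≠ 0 → p • P ≠ 0) :
    ∃ c : ℕ, c ≤ 4 ∧
      ((Nat.card K : ℤ) + 1 - Nat.card W.toAffine.Point) ^ 2 = c * (Nat.card K : ℤ) := by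
  obtain ⟨c, hc⟩ := W.card_dvd_trace_sq_of_forall_nsmul_ne_zero p hσ hnone
  have hle := W.trace_sq_le_four_mul_card
  have hq : (0 : ℤ) < (Nat.card K : ℤ) := by
    letI := Fintype.ofFinite K
    rw [Nat.card_eq_fintype_card]
    exact_mod_cast Fintype.card_pos
  have hc' : ((Nat.card K : ℕ) : ℤ) = (Nat.card K : ℤ) := rfl
  rw [hc'] at hc
  have h0 : 0 ≤ c := by
    by_contra h
    push Not at h
    have : ((Nat.card K : ℤ) + 1 - Nat.card W.toAffine.Point) ^ 2 < 0 := by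
      rw [hc]
      exact mul_neg_of_pos_of_neg hq h
    exact absurd this (not_lt.mpr (sq_nonneg _))
  have h4 : c ≤ 4 := by
    by_contra h
    push Not at h
    have : 4 * (Nat.card K : ℤ) < ((Nat.card K : ℤ) + 1 - Nat.card W.toAffine.Point) ^ 2 := by
      rw [hc]
      nlinarith
    exact absurd hle (not_le.mpr this)
  obtain ⟨c, rfl⟩ := Int.eq_ofNat_of_zero_le h0
  exact ⟨c, by exact_mod_cast h4, by rw [hc, mul_comm]⟩

end Trace

end WeierstrassCurve
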